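import Literature.Probability.LatticeModels.PlaneRotatorInfraredEnergyFloor

/-!
# Route `AnisotropyChord` / H0 rotor rung, route (1): THE ONE-PARTICLE POINCARÉ INEQUALITY OF THE DISCRETE TORUS
# (spectral gap `1 − cos(2π/L)` of the random walk on `(ℤ/L)^d`, the random-walk input of the Caputo–Liggett–Richthammer
# comparison used to discharge `FerroSectorGapCLR`)

For `g : (ℤ/L)^d → ℂ` with `Σ_x g x = 0` and `L ≥ 2`:

* (tree, `Literature.Probability.LatticeModels.sum_norm_shift_sub_sq`) `L^d Σ_x ‖g(x+eᵢ) − g x‖² =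
  Σ_k 2(1 − cos pᵢ(k)) ‖𝓕g(k)‖²`, `p = 2πk/L`;
* `one_sub_cos_le_sum_one_sub_cos` — a non-zero lattice momentum has `Σᵢ (1 − cos pᵢ) ≥ 1 − cos(2π/L)`;
* **`torus_poincare_shift`** — `(1 − cos(2π/L)) Σ_x ‖g x‖² ≤ ½ Σ_x Σ_i ‖g(x + eᵢ) − g x‖²` (Plancherel: the
  Fourier symbol of the right-hand side is `Σᵢ (1 − cos pᵢ(k))`, which is `≥ 1 − cos(2π/L)` off `k = 0`, and
  `𝓕g(0) = Σ g = 0`);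
* **`torus_poincare_adj`** (`d = 2`, `L ≥ 3`) — the same with the graph form of the torus Laplacian,
  `(1 − cos(2π/L)) Σ_x ‖g x‖² ≤ ¼ Σ_x Σ_y [x ∼ y] ‖g x − g y‖²` (`torusGraph 2 L`; for `L ≥ 3` the four points
  `x ± eᵢ` are distinct neighbours of `x`, `sum_adj_ge_four`; tree: `torusGraph_adj_add_single`, `torus_single_ne_zero`).

Friedli–Velenik (2017) §8.4 / §10.4 (lattice Laplacian symbol `2 Σᵢ (1 − cos pᵢ)`); Levin–Peres–Wilmer (2017) §12.3.1
(the cycle, `λ₂ = cos(2π/n)`).  Prover seat `hubbard-h0-rotor-p1` g20; helper for the S-bridge dossier of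
stmt-HubbardSuperconductivity-19089 (input of `…Transfer.ferroSectorGapCLR_holds`).  No definition is introduced.
-/

set_option linter.dupNamespace false
set_option autoImplicit false

noncomputable section

open Finset Complex
open scoped ComplexConjugate
open Literature.Probability.LatticeModels

namespace Summit.HubbardSuperconductivity.HubbardSuperconductivity.Theorems.AnisotropyChord.Transfer

variable {d L : ℕ} [NeZero L]

/-! ## Fourier side -/

/-- A non-zero momentum of `(ℤ/L)^d` has Laplacian symbol `Σᵢ (1 − cos pᵢ) ≥ 1 − cos(2π/L)` (`L ≥ 2`): some
coordinate `v = kᵢ.val ∈ [1, L − 1]` has `cos(2πv/L) ≤ cos(2π/L)` (reflect `v ↦ L − v` onto `[0, π]`). [folklore] -/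
theorem one_sub_cos_le_sum_one_sub_cos (hL : 2 ≤ L) {k : TorusSite d L} (hk : k ≠ 0) :
    1 - Real.cos (2 * Real.pi / L) ≤ ∑ i, (1 - Real.cos (latticeMomentum L k i)) := by
  obtain ⟨i, hi⟩ : ∃ i, k i ≠ 0 := by
    by_contra h
    push Not at h
    exact hk (funext h)
  have hLpos : (0 : ℝ) < L := by exact_mod_cast (by omega : 0 < L)
  -- `cos (2π v / L) ≤ cos (2π / L)` for `v = (k i).val`
  have hcos : Real.cos (2 * Real.pi * ((k i).val : ℝ) / L) ≤ Real.cos (2 * Real.pi / L) := by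
    have hv1 : (1 : ℝ) ≤ (k i).val := by
      exact_mod_cast Nat.one_le_iff_ne_zero.2 ((ZMod.val_ne_zero (k i)).2 hi)
    have hvL : ((k i).val : ℝ) ≤ L - 1 := by
      have h : (k i).val ≤ L - 1 := by have := ZMod.val_lt (k i); omega
      have h' := (Nat.cast_le (α := ℝ)).2 h
      rwa [Nat.cast_sub (by omega : 1 ≤ L), Nat.cast_one] at h'
    have hlow : 2 * Real.pi / L ≤ 2 * Real.pi * ((k i).val : ℝ) / L := by
      rw [div_le_div_iff_of_pos_right hLpos]; nlinarith [Real.pi_pos]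
    rcases le_or_gt (2 * Real.pi * ((k i).val : ℝ) / L) Real.pi with hle | hgt
    · exact Real.cos_le_cos_of_nonneg_of_le_pi (by positivity) hle hlow
    · rw [← Real.cos_two_pi_sub]
      have hup : 2 * Real.pi * ((k i).val : ℝ) / L ≤ 2 * Real.pi - 2 * Real.pi / L := by
        rw [div_le_iff₀ hLpos, sub_mul, div_mul_cancel₀ _ hLpos.ne']; nlinarith [Real.pi_pos]
      exact Real.cos_le_cos_of_nonneg_of_le_pi (by positivity) (by linarith) (by linarith)
  calc 1 - Real.cos (2 * Real.pi / L) ≤ 1 - Real.cos (latticeMomentum L k i) := by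
        simp only [latticeMomentum]
        linarith
    _ ≤ ∑ j, (1 - Real.cos (latticeMomentum L k j)) :=
        Finset.single_le_sum (f := fun j => 1 - Real.cos (latticeMomentum L k j))
          (fun j _ => by linarith [Real.cos_le_one (latticeMomentum L k j)]) (Finset.mem_univ i)

/-- **ONE-PARTICLE POINCARÉ INEQUALITY ON `(ℤ/L)^d` (shift form):** for `Σ_x g x = 0` and `L ≥ 2`,
`(1 − cos(2π/L)) Σ_x ‖g x‖² ≤ ½ Σ_x Σ_i ‖g(x + eᵢ) − g x‖²`. [folklore] -/
theorem torus_poincare_shift (hL : 2 ≤ L) (g : TorusSite d L → ℂ) (hg : ∑ x, g x = 0) :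
    (1 - Real.cos (2 * Real.pi / L)) * ∑ x, ‖g x‖ ^ 2
      ≤ (1 / 2 : ℝ) * ∑ x, ∑ i, ‖g (x + Pi.single i 1) - g x‖ ^ 2 := by
  have hLpos : (0 : ℝ) < (L : ℝ) ^ d := by
    have : (0 : ℝ) < L := by exact_mod_cast (by omega : 0 < L)
    positivity
  -- multiply through by `L^d` and pass to Fourier variables
  rw [← mul_le_mul_iff_of_pos_left hLpos]
  have hRHS : (L : ℝ) ^ d * ((1 / 2 : ℝ) * ∑ x, ∑ i, ‖g (x + Pi.single i 1) - g x‖ ^ 2)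
      = ∑ k, (∑ i, (1 - Real.cos (latticeMomentum L k i))) * ‖torusFourier g k‖ ^ 2 := by
    rw [Finset.sum_comm]
    have e1 : (L : ℝ) ^ d * ((1 / 2 : ℝ) * ∑ i, ∑ x, ‖g (x + Pi.single i 1) - g x‖ ^ 2)
        = (1 / 2 : ℝ) * ∑ i, ((L : ℝ) ^ d * ∑ x, ‖g (x + Pi.single i 1) - g x‖ ^ 2) := by
      rw [← Finset.mul_sum]
      ring
    rw [e1]
    have e2 : ∑ i, ((L : ℝ) ^ d * ∑ x, ‖g (x + Pi.single i 1) - g x‖ ^ 2)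
        = ∑ i, ∑ k, 2 * (1 - Real.cos (latticeMomentum L k i)) * ‖torusFourier g k‖ ^ 2 :=
      Finset.sum_congr rfl fun i _ => sum_norm_shift_sub_sq hL g i
    rw [e2, Finset.sum_comm, Finset.mul_sum]
    refine Finset.sum_congr rfl fun k _ => ?_
    rw [Finset.sum_mul, Finset.mul_sum]
    refine Finset.sum_congr rfl fun i _ => ?_
    ring
  have hLHS : (L : ℝ) ^ d * ((1 - Real.cos (2 * Real.pi / L)) * ∑ x, ‖g x‖ ^ 2)
      = ∑ k, (1 - Real.cos (2 * Real.pi / L)) * ‖torusFourier g k‖ ^ 2 := by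
    rw [← Finset.mul_sum, torusFourier_plancherel_holds (d := d) (L := L) g]
    ring
  rw [hRHS, hLHS]
  refine Finset.sum_le_sum fun k _ => ?_
  by_cases hk : k = 0
  · -- the zero mode carries no weight: `𝓕g(0) = Σ g = 0`
    subst hk
    rw [torusFourier_apply_zero, hg, norm_zero]
    simp
  · exact mul_le_mul_of_nonneg_right (one_sub_cos_le_sum_one_sub_cos hL hk) (sq_nonneg _)

/-! ## Graph form on the two-dimensional torus (`L ≥ 3`) -/

section TwoDim

variable {L : ℕ}

/-- `eᵢ = eⱼ → i = j`. [folklore] -/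
theorem single_inj_torus (hL : 2 ≤ L) {i j : Fin 2}
    (h : (Pi.single i 1 : TorusSite 2 L) = Pi.single j 1) : i = j := by
  haveI : Fact (1 < L) := ⟨by omega⟩
  by_contra hij
  have := congrFun h i
  rw [Pi.single_eq_same, Pi.single_eq_of_ne hij] at this
  exact one_ne_zero this

/-- the backward neighbour `x − eᵢ` is adjacent to `x` (`L ≥ 2`). [folklore] -/
theorem adj_sub_single (hL : 2 ≤ L) (x : TorusSite 2 L) (i : Fin 2) :
    (torusGraph 2 L).Adj x (x - Pi.single i 1) := by
  rw [torusGraph_adj_iff]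
  refine ⟨fun h => torus_single_ne_zero hL i ?_, Or.inr ⟨i, by rw [sub_add_cancel]⟩⟩
  have h' : x + (-Pi.single i 1) = x := by rw [← sub_eq_add_neg]; exact h.symm
  exact neg_eq_zero.mp (add_eq_left.mp h')

variable [NeZero L]

/-- **The neighbour sum dominates the sum over the four lattice neighbours** (`L ≥ 3`, non-negative summand):
`Σᵢ (F(x + eᵢ) + F(x − eᵢ)) ≤ Σ_y [x ∼ y] F y`. [folklore] -/
theorem sum_adj_ge_four (hL : 3 ≤ L) (x : TorusSite 2 L) (F : TorusSite 2 L → ℝ) (hF : ∀ y, 0 ≤ F y) :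
    ∑ i : Fin 2, (F (x + Pi.single i 1) + F (x - Pi.single i 1))
      ≤ ∑ y, (if (torusGraph 2 L).Adj x y then F y else 0) := by
  classical
  have hL2 : 2 ≤ L := by omega
  haveI : Fact (1 < L) := ⟨by omega⟩
  -- `eᵢ + eⱼ ≠ 0` for `L ≥ 3` (`2 ≠ 0` and `1 ≠ 0` in `ℤ/L`)
  have hee : ∀ i j : Fin 2, (Pi.single i 1 : TorusSite 2 L) + Pi.single j 1 ≠ 0 := by
    intro i j h
    have hi := congrFun h i
    by_cases hij : j = i
    · subst hij
      simp only [Pi.add_apply, Pi.single_eq_same, Pi.zero_apply] at hi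
      have h2 : ((2 : ℕ) : ZMod L) = 0 := by
        have : (1 : ZMod L) + 1 = ((2 : ℕ) : ZMod L) := by norm_num
        rw [this] at hi
        exact hi
      rw [ZMod.natCast_eq_zero_iff] at h2
      have := Nat.le_of_dvd (by norm_num) h2
      omega
    · simp only [Pi.add_apply, Pi.single_eq_same, Pi.single_eq_of_ne (Ne.symm hij), Pi.zero_apply,
        add_zero] at hi
      exact one_ne_zero hi
  -- pairwise distinctness of the four neighbours
  have hpm : ∀ i j : Fin 2, x + Pi.single i 1 ≠ x - Pi.single j (1 : ZMod L) := by
    intro i j h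
    apply hee i j
    have h2 : x + (Pi.single i 1 + Pi.single j 1) = x := by rw [← add_assoc, h, sub_add_cancel]
    exact add_eq_left.mp h2
  have h13 : x + Pi.single (0 : Fin 2) (1 : ZMod L) ≠ x + Pi.single (1 : Fin 2) 1 := fun h =>
    absurd (single_inj_torus hL2 (add_left_cancel h)) (by decide)
  have h24 : x - Pi.single (0 : Fin 2) (1 : ZMod L) ≠ x - Pi.single (1 : Fin 2) 1 := fun h =>
    absurd (single_inj_torus hL2 (sub_right_inj.mp h)) (by decide)
  -- the restricted sum
  let G : TorusSite 2 L → ℝ := fun y => if (torusGraph 2 L).Adj x y then F y else 0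
  have hGnn : ∀ y, 0 ≤ G y := fun y => by
    simp only [G]
    split_ifs
    · exact hF y
    · exact le_refl _
  have hGp : ∀ i : Fin 2, G (x + Pi.single i 1) = F (x + Pi.single i 1) := fun i => by
    simp only [G, torusGraph_adj_add_single hL2 x i, if_true]
  have hGm : ∀ i : Fin 2, G (x - Pi.single i 1) = F (x - Pi.single i 1) := fun i => by
    simp only [G, adj_sub_single hL2 x i, if_true]
  let s : Finset (TorusSite 2 L) :=
    {x + Pi.single 0 1, x - Pi.single 0 1, x + Pi.single 1 1, x - Pi.single 1 1}
  have hsum : ∑ y ∈ s, G y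
      = G (x + Pi.single 0 1) + G (x - Pi.single 0 1) + G (x + Pi.single 1 1) + G (x - Pi.single 1 1) := by
    rw [Finset.sum_insert, Finset.sum_insert, Finset.sum_insert, Finset.sum_singleton]
    · ring
    · simp [hpm 1 1]
    · simp [Ne.symm (hpm 1 0), h24]
    · simp [hpm 0 0, h13, hpm 0 1]
  calc ∑ i : Fin 2, (F (x + Pi.single i 1) + F (x - Pi.single i 1))
      = G (x + Pi.single 0 1) + G (x - Pi.single 0 1) + G (x + Pi.single 1 1) + G (x - Pi.single 1 1) := by
        rw [Fin.sum_univ_two, hGp, hGp, hGm, hGm]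
        ring
    _ = ∑ y ∈ s, G y := hsum.symm
    _ ≤ ∑ y, G y := Finset.sum_le_sum_of_subset_of_nonneg (Finset.subset_univ s) (fun y _ _ => hGnn y)

/-- **ONE-PARTICLE POINCARÉ INEQUALITY ON THE TORUS GRAPH `(ℤ/L)²`, `L ≥ 3`:** for `Σ_x g x = 0`,
`(1 − cos(2π/L)) Σ_x ‖g x‖² ≤ ¼ Σ_x Σ_y [x ∼ y] ‖g x − g y‖²` — the random walk with rate `½` per edge has
spectral gap at least the one-magnon gap `1 − cos(2π/L)`. [folklore] -/
theorem torus_poincare_adj (hL : 3 ≤ L) (g : TorusSite 2 L → ℂ) (hg : ∑ x, g x = 0) :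
    (1 - Real.cos (2 * Real.pi / L)) * ∑ x, ‖g x‖ ^ 2
      ≤ (1 / 4 : ℝ) * ∑ x, ∑ y, (if (torusGraph 2 L).Adj x y then ‖g x - g y‖ ^ 2 else 0) := by
  have hL2 : 2 ≤ L := by omega
  have h1 := torus_poincare_shift hL2 g hg
  -- backward differences re-index to forward differences
  have hback : ∀ i : Fin 2,
      ∑ x, ‖g x - g (x - Pi.single i 1)‖ ^ 2 = ∑ x, ‖g (x + Pi.single i 1) - g x‖ ^ 2 := by
    intro i
    exact (Fintype.sum_equiv (Equiv.addRight (Pi.single i (1 : ZMod L)))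
      (fun x => ‖g (x + Pi.single i 1) - g x‖ ^ 2) (fun x => ‖g x - g (x - Pi.single i 1)‖ ^ 2)
      (fun x => by simp)).symm
  have hfour : ∑ x, ∑ i : Fin 2, (‖g x - g (x + Pi.single i 1)‖ ^ 2 + ‖g x - g (x - Pi.single i 1)‖ ^ 2)
      ≤ ∑ x, ∑ y, (if (torusGraph 2 L).Adj x y then ‖g x - g y‖ ^ 2 else 0) :=
    Finset.sum_le_sum fun x _ => sum_adj_ge_four hL x (fun y => ‖g x - g y‖ ^ 2) (fun y => sq_nonneg _)
  have hsplit : ∑ x, ∑ i : Fin 2, (‖g x - g (x + Pi.single i 1)‖ ^ 2 + ‖g x - g (x - Pi.single i 1)‖ ^ 2)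
      = 2 * ∑ x, ∑ i : Fin 2, ‖g (x + Pi.single i 1) - g x‖ ^ 2 := by
    rw [two_mul]
    simp only [Finset.sum_add_distrib]
    congr 1
    · refine Finset.sum_congr rfl fun x _ => Finset.sum_congr rfl fun i _ => ?_
      rw [norm_sub_rev]
    · rw [Finset.sum_comm, Finset.sum_congr rfl fun i _ => hback i]
      exact Finset.sum_comm
  rw [hsplit] at hfour
  linarith

end TwoDim

end Summit.HubbardSuperconductivity.HubbardSuperconductivity.Theorems.AnisotropyChord.Transfer

end
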